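import Summits.ResolutionOfSingularities.ResolutionOfSingularities.Theorems.AbsoluteContactAxes
import HarnessLib

/-!
# AbsoluteGiraudKernel — decomp-res node «AbsoluteGiraud» (lens-6 g16), tree file 6/7: §6 (NEW · KERNEL)
GIRAUD PERSISTENCE OF ABSOLUTE
CONTACT UNDER ONE BLOWING UP, scheme level, ANY marking `n + 1`, universe-generic, tree imports only:
`isRsopPart_one_of_not_mem_sq`,
`point_round_chart` (the point round in a Rees chart: `z = t·z′`, `(t)` prime, `z′ ∉ 𝔪²`, `t ∉
(z′)`), `giraud_point` (Giraud's lemma read over `ℤ`: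
`z ∈ Diff^{≤n}_ℤ(I_x)`, `I_x ≤ 𝔪^{n+1}` ⇒ `z′ ∈ Diff^{≤n}_ℤ(I′_y)`), the invariant `AbsInv I
H n y` and the two rounds `absInv_point` / `absInv_foreign`.
All PROVED (critic row 118 r1: Literature-grade; landed Summits-side because the Literature gate accepts only cited
published statements; lens-4's
`FactorContactPort` persistence step (T2)–(T3) is exactly `absInv_point` with `hC : C_x = 𝔪_x`, row 117 r3).

Content VERBATIM from the decomp-res lens-6 g16 file `HOME/decomp-res-lens-6/g16/AbsoluteGiraud.lean` (sha256
bc25b5879a7322cd; CRITIC-LEDGER row 118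
CLEARED: MAP +1; it SUPERSEDES g15 `AbsoluteContact.lean` cca8a261, rows 110–112, whose §1–§5 are
byte-identical).  HOME = run/shared/lean/pub/decomp-res.
Host: route `MaxContactCut`, aside 31574 `PVPureGame` through the lens-6 chain SatelliteExit (tree
`Theorems/SatelliteExitClasses`) → g12–g14
BoundaryValve / SwitchExclusion / MemberCalculus (HOME, critic rows 87/93/103; not yet in the tree) → the scope
class `AllHug3Off3` (§1 here).

[WRITER NOTE (decomp-res writer g6): the lens file is split into `AbsoluteContactScope` (§0 g12 vocabulary over the
landed `Branch` + §1 the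
scope class and the perfect half) → `AbsoluteContactPrimitives` (§2, landed earlier) →
`AbsoluteContactHasseRing` / `AbsoluteContactHasse` (§3a/§3
the separable-residue Hasse lemma IN KERNEL) → `AbsoluteContactAxes` (§4/§5 the two axes: residue field of the
root point; absolute contact) →
`AbsoluteGiraudKernel` (§6 scheme-level Giraud persistence of absolute contact under one blowing up) →
`AbsoluteGiraudBranch` (§7 `absGiraud3`,
§8 assembly).  The two Theses-cone imports of the lens file (`Theses.MaxContactCut`, `MaxContactCutPurityValve`)
are unused and dropped, so every
file is route-importable; `set_option` lines dropped; nothing else changed.]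
(Sources: Giraud1975; EncinasVillamayor2000 Thm. 4.9; BravoGarciaEscamillaVillamayor2012 Lemma 4.6;
VillamayorU2008ReesDiff §4; CossartPiltant2008 §2; CossartJannsenSaito2020.)
-/

noncomputable section

open CategoryTheory AlgebraicGeometry TopologicalSpace
open Literature.AlgebraicGeometry.Resolution
open Summit.ResolutionOfSingularities.ResolutionOfSingularities.Theorems
open WeakOrderReduction ForcedTowerClasses PurityValveClasses
open SatelliteExitClasses

namespace Summit.ResolutionOfSingularities.ResolutionOfSingularities.Theorems.AbsoluteContactClasses

/-! ## §6 (g16 · NEW · KERNEL) Giraud persistence of ABSOLUTE contact under one blowing up — scheme level, any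
marking `n + 1` -/

section GiraudKernel

open IsLocalRing

universe uG

/-! ## One-element parts of a regular system of parameters -/

/-- In a regular local ring an element of `𝔪 ∖ 𝔪²` is a one-element part of a regular system of
parameters (verbatim the tree's `ShannonSequence.LowMult.isRsopPart_one_of_not_mem_sq`). (Sources: Matsumura1987, Thm. 14.2.) -/
theorem isRsopPart_one_of_not_mem_sq {R : Type uG} [CommRing R] [IsRegularLocalRing R] {h : R}
    (hh : h ∈ maximalIdeal R) (hh2 : h ∉ maximalIdeal R ^ 2) : IsRsopPart (fun _ : Fin 1 => h) := by
  obtain ⟨hq, hdim⟩ := IsRegularLocalRing.quotient_span_singleton hh hh2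
  have hr : Set.range (fun _ : Fin 1 => h) = {h} := Set.range_const
  have hq' : IsRegularLocalRing (R ⧸ Ideal.span (Set.range fun _ : Fin 1 => h)) := by rw [hr]; exact hq
  have hdim' : ringKrullDim (R ⧸ Ideal.span (Set.range fun _ : Fin 1 => h)) + (1 : ℕ) ≤ ringKrullDim R := by
    rw [hr, Nat.cast_one]
    exact hdim.le
  exact IsRsopPart.of_isRegularLocalRing_quotient (fun _ => hh) (hq := hq') hdim'

/-! ## The point round: chart computation -/

variable {X X' : Scheme.{uG}} {π : X' ⟶ X} {C : X.IdealSheafData}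

/-- **Point round, chart side.** `π` the blowing up of the regular local scheme germ `(X, x)` in the closed point
`x = π y` (`C_x = 𝔪_x`), `H_x = (z)` with `z ∈ 𝔪_x ∖ 𝔪_x²`. Then, in `𝒪_{X',y}`: the exceptional
ideal is `(t)`,
`t = π^* 𝔷` a non-zero-divisor for some `𝔷 ∈ 𝒪_{X,x}`; `π^* z = t · z'` with `(z')` the controlled transform
`(π^{-1}H : E)` of `H`; and if `z' ∈ 𝔪_y` then `z' ∉ 𝔪_y²`, `(z')` is prime and `t ∉ (z')` — because
`(t, z')` is part of the regular system of parameters `(c_i, c_j/c_i, …)` of the local ring of the blow-up chart.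
(Sources: StacksProject, Tag 0BIQ; Matsumura1987, Thm. 14.2.) -/
theorem point_round_chart (hπ : IsBlowup π C) (y : X') [IsRegularLocalRing (X.presheaf.stalk (π y))]
    (hC : stalkIdeal C (π y) = maximalIdeal (X.presheaf.stalk (π y)))
    {z : X.presheaf.stalk (π y)} (hz1 : z ∈ maximalIdeal _) (hz2 : z ∉ maximalIdeal _ ^ 2)
    {H : X.IdealSheafData} (hH : stalkIdeal H (π y) = Ideal.span {z}) :
    ∃ (𝔷 : X.presheaf.stalk (π y)) (z' : X'.presheaf.stalk y),
      stalkIdeal (C.comap π) y = Ideal.span {(π.stalkMap y).hom 𝔷} ∧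
      (π.stalkMap y).hom 𝔷 ∈ nonZeroDivisors (X'.presheaf.stalk y) ∧
      (π.stalkMap y).hom z = (π.stalkMap y).hom 𝔷 * z' ∧
      stalkIdeal (controlledTransform π C H 1) y = Ideal.span {z'} ∧
      (z' ∈ maximalIdeal (X'.presheaf.stalk y) →
        z' ∉ maximalIdeal (X'.presheaf.stalk y) ^ 2 ∧ (Ideal.span {z'}).IsPrime ∧
          (π.stalkMap y).hom 𝔷 ∉ Ideal.span {z'}) := by
  classical
  have hrs : IsRsopPart (fun _ : Fin 1 => z) := isRsopPart_one_of_not_mem_sq hz1 hz2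
  obtain ⟨e, c, hd, hc, hc0⟩ := hrs.exists_rsop
  set j0 : Fin (1 + e) := Fin.castAdd e 0 with hj0def
  have hcj0 : c j0 = z := hc0 0
  have hcC : Ideal.span (Set.range c) = stalkIdeal C (π y) := hc.trans hC.symm
  have hTH : Ideal.span (c '' {j0}) = stalkIdeal H (π y) := by
    rw [Set.image_singleton, hcj0, hH]
  obtain ⟨i, 𝔴, χ, hχ, hloc, h𝔴⟩ := hπ.exists_reesChart_stalk y c hcC
  obtain ⟨hE, hH'⟩ := hπ.stalkIdeal_controlledTransform_eq_span_chartGen y c hcC {j0} hTH i 𝔴 χ hχ hloc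
  letI alg : Algebra (chartRing c i) (X'.presheaf.stalk y) := χ.toAlgebra
  haveI : IsLocalization.AtPrime (X'.presheaf.stalk y) 𝔴.asIdeal := hloc
  have halg : ∀ b, algebraMap (chartRing c i) (X'.presheaf.stalk y) b = χ b := fun b => by
    rw [RingHom.algebraMap_toAlgebra]
  refine ⟨c i, χ (chartGen c i j0), ?_, ?_, ?_, ?_, ?_⟩
  · rw [hE, hχ]
  · rw [← hχ, ← halg]
    exact IsLocalization.nonZeroDivisors_le_comap 𝔴.asIdeal.primeCompl _
      (reesChartBase_mem_nonZeroDivisors _ _)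
  · rw [← hcj0, ← hχ, ← hχ, reesChartBase_apply_eq_mul_chartGen c i j0, map_mul]
  · rw [hH', Set.image_singleton]
  · intro hz'm
    have hmem𝔴 : chartGen c i j0 ∈ 𝔴.asIdeal := by
      have h2 : χ (chartGen c i j0) ∈ maximalIdeal (X'.presheaf.stalk y) := hz'm
      rw [← halg] at h2
      exact (IsLocalization.AtPrime.to_map_mem_maximal_iff (X'.presheaf.stalk y) 𝔴.asIdeal _).mp h2
    have hj0i : j0 ≠ i := by
      intro h
      have h1 : chartGen c i j0 = 1 := by rw [h]; exact chartGen_self c i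
      rw [h1] at hmem𝔴
      exact 𝔴.isPrime.ne_top ((Ideal.eq_top_iff_one _).mpr hmem𝔴)
    -- empty complementary family
    let w : Fin 0 → X.presheaf.stalk (π y) := fun k => k.elim0
    have hrange : Set.range (Fin.append c w) = Set.range c := by
      ext a
      constructor
      · rintro ⟨m, rfl⟩
        refine Fin.addCases (fun j => ?_) (fun k => k.elim0) m
        exact ⟨j, by rw [Fin.append_left]⟩
      · rintro ⟨j, rfl⟩
        exact ⟨Fin.castAdd 0 j, by rw [Fin.append_left]⟩
    have hzw : Ideal.span (Set.range (Fin.append c w)) = maximalIdeal _ := by rw [hrange, hc]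
    have hd' : (maximalIdeal (X.presheaf.stalk (π y))).spanFinrank = (1 + e) + 0 := by
      rw [hd, Nat.add_zero]
    let jJ : Fin 1 → {j : Fin (1 + e) // j ≠ i} := fun _ => ⟨j0, hj0i⟩
    have hjJ : Function.Injective jJ := Function.injective_of_subsingleton _
    haveI : 𝔴.asIdeal.IsPrime := 𝔴.isPrime
    have hR := isRsopPart_chartFamily_reesChart c i w hzw hd' 𝔴.asIdeal h𝔴 (X'.presheaf.stalk y) jJ hjJ
      (fun _ => hmem𝔴)
    have hy : y ∈ (controlledTransform π C H 1).support := by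
      rw [mem_support_iff_stalkIdeal_le, hH', Set.image_singleton, Ideal.span_le, Set.singleton_subset_iff]
      exact hz'm
    have key := hπ.isPrime_stalkIdeal_controlledTransform_of_rsop y c w hzw hd' hcC {j0} hTH hy
    have hH'' : stalkIdeal (controlledTransform π C H 1) y = Ideal.span {χ (chartGen c i j0)} := by
      rw [hH', Set.image_singleton]
    refine ⟨?_, ?_, fun h => key.2 ?_⟩
    · have h5 := hR.not_mem_sq (Fin.succ (Fin.castAdd 0 0))
      simp only [chartFamily, Fin.cons_succ, Fin.append_left, halg, jJ] at h5
      exact h5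
    · rw [← hH'']
      exact key.1
    · have hE1 : stalkIdeal (C.comap π) y = Ideal.span {(π.stalkMap y).hom (c i)} := by rw [hE, hχ]
      rw [hE1, hH'']
      exact (Ideal.span_singleton_le_iff_mem _).mpr h

/-! ## The point round: Giraud's lemma over `ℤ` -/

/-- **Giraud's lemma at `k = ℤ`, point round.** With `C_x = 𝔪_x`, `E_y = (t)`, `t = π^*𝔷` a non-zero-divisor,
`I_x ⊆ 𝔪_x³`: if `z ∈ Diff_ℤ^{≤2}(I_x)` and `π^*z = t·z'` then `z' ∈ Diff_ℤ^{≤2}((I')_y)`, `I' =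
(π^{-1}I : E³)` the
controlled transform — from the stalk shift law `t²·π^*(Dh) = t³·Δ(w)` for `π^*h = t³ w`. (Sources:
BravoGarciaEscamillaVillamayor2012, Lemma 4.6; EncinasVillamayor2000, Thm. 4.9.) -/
theorem giraud_point (hπ : IsBlowup π C) (y : X') [IsNoetherianRing (X.presheaf.stalk (π y))]
    (hC : stalkIdeal C (π y) = maximalIdeal (X.presheaf.stalk (π y)))
    (𝔷 : X.presheaf.stalk (π y)) (hE : stalkIdeal (C.comap π) y = Ideal.span {(π.stalkMap y).hom 𝔷})
    (hnzd : (π.stalkMap y).hom 𝔷 ∈ nonZeroDivisors (X'.presheaf.stalk y))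
    (I : X.IdealSheafData) (n : ℕ) (hIn : stalkIdeal I (π y) ≤ maximalIdeal _ ^ (n + 1))
    {z : X.presheaf.stalk (π y)} (hz : z ∈ diffIdeal ℤ n (stalkIdeal I (π y)))
    {z' : X'.presheaf.stalk y} (hzz' : (π.stalkMap y).hom z = (π.stalkMap y).hom 𝔷 * z') :
    z' ∈ diffIdeal ℤ n (stalkIdeal (controlledTransform π C I (n + 1)) y) := by
  set σ := (π.stalkMap y).hom with hσ
  set t := σ 𝔷 with ht
  have hfg : (stalkIdeal C (π y)).FG := by
    rw [hC]; exact (isNoetherianRing_iff_ideal_fg _).mp inferInstance _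
  have key := hπ.exists_isDiffOpLE_stalk_shift (Int.castRingHom Γ(X, ⊤)) y hfg 𝔷 hE.symm
  have e1 : stalkAlgebra (Int.castRingHom Γ(X, ⊤)) (π y) = Ring.toIntAlgebra _ := Subsingleton.elim _ _
  have e2 : stalkAlgebra (π.appTop.hom.comp (Int.castRingHom Γ(X, ⊤))) y = Ring.toIntAlgebra _ :=
    Subsingleton.elim _ _
  rw [e1, e2] at key
  -- the controlled transform as a colon ideal
  have hI' : stalkIdeal (controlledTransform π C I (n + 1)) y =
      Submodule.colon ((stalkIdeal I (π y)).map σ) {t ^ (n + 1)} := by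
    rw [hπ.stalkIdeal_controlledTransform I (n + 1) y, stalkIdeal_comap_eq_map_stalkMap, hE,
      Ideal.span_singleton_pow, Submodule.colon_span]
  have hle : diffIdeal ℤ n (stalkIdeal I (π y)) ≤
      (Ideal.span {t} * diffIdeal ℤ n (stalkIdeal (controlledTransform π C I (n + 1)) y)).comap σ := by
    rw [diffIdeal_le_iff]
    intro D hD h hh
    rw [Ideal.mem_comap]
    obtain ⟨Δ, hΔ, hshift⟩ := key n (n + 1) D hD
    have h3 : σ h ∈ Ideal.span {t ^ (n + 1)} := by
      have hm : σ h ∈ (maximalIdeal _ ^ (n + 1)).map σ := Ideal.mem_map_of_mem _ (hIn hh)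
      rw [Ideal.map_pow, ← hC, ← stalkIdeal_comap_eq_map_stalkMap, hE, Ideal.span_singleton_pow] at hm
      exact hm
    obtain ⟨w, hw⟩ := Ideal.mem_span_singleton'.mp h3
    have hwI' : w ∈ stalkIdeal (controlledTransform π C I (n + 1)) y := by
      rw [hI', Submodule.mem_colon_singleton, smul_eq_mul, hw]
      exact Ideal.mem_map_of_mem _ hh
    have hsh := hshift h w (by rw [← hw, mul_comm])
    have hDh : σ (D h) = t * Δ w := by
      have h2 : t ^ n * σ (D h) = t ^ n * (t * Δ w) := by rw [hsh]; ring
      exact (mul_cancel_left_mem_nonZeroDivisors (pow_mem hnzd n)).mp h2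
    rw [hDh]
    exact Ideal.mul_mem_mul (Ideal.mem_span_singleton_self _) (apply_mem_diffIdeal ℤ hΔ hwI')
  have hz' : σ z ∈ Ideal.span {t} * diffIdeal ℤ n (stalkIdeal (controlledTransform π C I (n + 1)) y) := hle hz
  rw [hzz', Ideal.mem_span_singleton_mul] at hz'
  obtain ⟨b, hb, hbe⟩ := hz'
  have : b = z' := (mul_cancel_left_mem_nonZeroDivisors hnzd).mp hbe
  rw [← this]; exact hb

/-! ## The invariant and the two rounds -/

/-- **Stage invariant** of the absolute-contact persistence: `H_y = (z)` with `z ∈ Diff_ℤ^{≤2}(I_y)` a regular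
parameter (`z ∈ 𝔪_y ∖ 𝔪_y²`). [this file] -/
def AbsInv {Y : Scheme.{uG}} (I H : Y.IdealSheafData) (n : ℕ) (y : Y) : Prop :=
  ∃ z : Y.presheaf.stalk y, stalkIdeal H y = Ideal.span {z} ∧ z ∈ diffIdeal ℤ n (stalkIdeal I y) ∧
    z ∈ maximalIdeal (Y.presheaf.stalk y) ∧ z ∉ maximalIdeal (Y.presheaf.stalk y) ^ 2

/-- **Point round.** Blow up the closed point `x = π y` (`V(C) = {x}`, `V(C)` a regular subscheme) of the regular
locally Noetherian `X`; if `I_x ⊆ 𝔪_x³`, `(I')_y ⊆ 𝔪_y³` (`I' = (π^{-1} I : E³)`) and `AbsInv I H x`, then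
`AbsInv I' H' y` for the strict transform `H'` of `H`. (Sources: EncinasVillamayor2000, Thm. 4.9; StacksProject, Tag 0BIQ.) -/
theorem absInv_point (hπ : IsBlowup π C) [IsLocallyNoetherian X] [IsLocallyNoetherian X']
    (hX : Scheme.IsRegular X) (hCreg : Scheme.IsRegular C.subscheme) (I H : X.IdealSheafData) (n : ℕ) (y : X')
    (hcl : IsClosed ({π y} : Set X)) (hpt : (C.support : Set X) = {π y})
    (hIn : stalkIdeal I (π y) ≤ maximalIdeal _ ^ (n + 1))
    (hI'n : stalkIdeal (controlledTransform π C I (n + 1)) y ≤ maximalIdeal _ ^ (n + 1))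
    (h : AbsInv I H n (π y)) :
    AbsInv (controlledTransform π C I (n + 1)) (strictTransformIdeal π C H) n y := by
  obtain ⟨z, hHz, hzD, hz1, hz2⟩ := h
  haveI : IsRegularLocalRing (X.presheaf.stalk (π y)) := hX _
  have hCst : stalkIdeal C (π y) = maximalIdeal _ := by
    rw [eq_vanishingIdeal_support_of_isRegular C hCreg]
    apply stalkIdeal_vanishingIdeal_eq_maximalIdeal_of_closure_eq
    rw [hpt, hcl.closure_eq]
  obtain ⟨𝔷, z', hE, hnzd, hzz', hweak, hreg⟩ := point_round_chart hπ y hCst hz1 hz2 hHz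
  have hz'D : z' ∈ diffIdeal ℤ n (stalkIdeal (controlledTransform π C I (n + 1)) y) :=
    giraud_point hπ y hCst 𝔷 hE hnzd I n hIn hzD hzz'
  have hz'm : z' ∈ maximalIdeal _ := diffIdeal_le_of_le_pow_succ ℤ (n := n) hI'n hz'D
  obtain ⟨hz'2, hprime, ht⟩ := hreg hz'm
  refine ⟨z', ?_, hz'D, hz'm, hz'2⟩
  set σ := (π.stalkMap y).hom
  set t := σ 𝔷
  rw [stalkIdeal_strictTransformIdeal π C H y, hHz, Ideal.map_span, Set.image_singleton, hzz', hE]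
  apply le_antisymm
  · refine iSup_le fun m => fun a ha => ?_
    have h1 : a * t ^ m ∈ Ideal.span {z'} := by
      have h2 : a * t ^ m ∈ Ideal.span {t * z'} :=
        Submodule.mem_colon.mp ha (t ^ m) (Ideal.pow_mem_pow (Ideal.mem_span_singleton_self _) m)
      exact Ideal.span_singleton_le_iff_mem _ |>.mpr
        (Ideal.mul_mem_left _ t (Ideal.mem_span_singleton_self z')) h2
    rcases hprime.mem_or_mem h1 with h3 | h3
    · exact h3
    · exact absurd (hprime.mem_of_pow_mem m h3) ht
  · refine le_iSup_of_le 1 fun a ha => ?_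
    obtain ⟨c, rfl⟩ := Ideal.mem_span_singleton'.mp ha
    refine Submodule.mem_colon.mpr fun s hs => ?_
    rw [pow_one] at hs
    obtain ⟨b, rfl⟩ := Ideal.mem_span_singleton'.mp hs
    rw [smul_eq_mul, show c * z' * (b * t) = (c * b) * (t * z') by ring]
    exact Ideal.mul_mem_left _ _ (Ideal.mem_span_singleton_self _)

/-- **Foreign round.** If the followed point `y` lies over a point `π y ∉ V(C)` then `π` is a local isomorphism at
`y`, all transforms are pull-backs, and `AbsInv` is transported along the ring isomorphism `π^*_y` (differential
operators over `ℤ` are intrinsic: `IsDiffOpLE.algEquivConj`). (Sources: EGAIV4, Prop. 16.8.8.) -/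
theorem absInv_foreign (hπ : IsBlowup π C) [IsLocallyNoetherian X] [IsLocallyNoetherian X']
    (I H : X.IdealSheafData) (n μ : ℕ) (y : X') (hy : π y ∉ (C.support : Set X)) (h : AbsInv I H n (π y)) :
    AbsInv (controlledTransform π C I μ) (strictTransformIdeal π C H) n y := by
  obtain ⟨z, hHz, hzD, hz1, hz2⟩ := h
  have hy' : π y ∉ C.support := hy
  haveI := hπ.isIso_stalkMap_of_not_mem_support hy'
  have hbij := ConcreteCategory.bijective_of_isIso (π.stalkMap y)
  set σ := (π.stalkMap y).hom with hσ
  let e : X.presheaf.stalk (π y) ≃+* X'.presheaf.stalk y := RingEquiv.ofBijective σ hbij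
  let eA : X.presheaf.stalk (π y) ≃ₐ[ℤ] X'.presheaf.stalk y :=
    AlgEquiv.ofRingEquiv (f := e) (fun x => by simp)
  have hmapA : ∀ J : Ideal (X.presheaf.stalk (π y)), J.map eA = J.map σ := fun J => rfl
  refine ⟨σ z, ?_, ?_, ?_, ?_⟩
  · rw [hπ.stalkIdeal_strictTransformIdeal_of_not_mem H hy', stalkIdeal_comap_eq_map_stalkMap, hHz,
      Ideal.map_span, Set.image_singleton]
  · rw [hπ.stalkIdeal_controlledTransform_of_not_mem I μ hy', stalkIdeal_comap_eq_map_stalkMap, ← hmapA,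
      ← diffIdeal_map_algEquiv, hmapA]
    exact Ideal.mem_map_of_mem _ hzD
  · rw [← map_ringEquiv_maximalIdeal e]
    exact Ideal.mem_map_of_mem _ hz1
  · exact (notMem_sq_maximalIdeal_iff_of_ringEquiv e z).mp hz2

end GiraudKernel

end Summit.ResolutionOfSingularities.ResolutionOfSingularities.Theorems.AbsoluteContactClasses
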